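import Literature.Geometry.Lorentzian.TeukolskyRadialConjugation
import Literature.Geometry.Lorentzian.TeukolskyRadialSchrodingerForm
import Literature.Geometry.Lorentzian.TeukolskyHorizonNormalisedLimits
import Literature.Geometry.Lorentzian.TeukolskyInfinityNormalisedLimits
import Literature.Geometry.Lorentzian.TeukolskyRadialFluxInfinity
import Literature.Geometry.Lorentzian.KerrSurfaceGravity
import Literature.Geometry.Lorentzian.KerrTortoiseRadius

/-!
# The TdC kernel bound from its tortoise-variable core
# (stub `stub_tortoiseReduction`, S5a-R of the line `olver-dunster-uniform-reduction`)

Crux `PhaseMixingCapture.KappaExplicitWaveDecay` (stmt-FinalStateConjecture-10654), line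
`olver-dunster-uniform-reduction`, stub S5a-R (skeleton v4). The cone Green-kernel bound for the
normalised scalar radial Teukolsky pair `R_𝓗`, `R_𝓘` (Teixeira da Costa 2020, Def. 2.3, `s = 0`),

  `√(r²+a²)‖R_𝓗 r‖ · √(r′²+a²)‖R_𝓘 r′‖ ≤ C|m|^N κ^{-N} ‖𝔚(r)‖`, `r₊ < r ≤ r′`, `r′ ≥ r₊ + θ(r₊ − r₋)`,

for all `m ≠ 0` in a cone `|ω − mω₊| ≤ ε₀|m|` under a frequency regime `P` invariant under
`(ω, m) ↦ (−ω, −m)`, FOLLOWS from its core stated in Carter's tortoise variable: the same two-point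
bound `‖u_𝓗 x‖·‖u_𝓘 x′‖ ≤ C|m|^N κ^{-N}‖u_𝓗 u_𝓘′ − u_𝓘 u_𝓗′‖(x)` for solutions of
`u″ + (ω² − V(ρ x))u = 0` (`V = Kerr.sepPotential`, `ρ` a tortoise radius function) with the
horizon data `‖u_𝓗‖ → 1`, `‖u_𝓗′‖ → |ω − mω₊|`, `Im(ū_𝓗 u_𝓗′) ≡ −(ω − mω₊)` at `x → −∞`, the infinity
data `‖u_𝓘‖ → 1`, `‖u_𝓘′‖ → |ω|`, `Im(ū_𝓘 u_𝓘′) ≡ ω` at `x → +∞`, and `0 < m`.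

Pure plumbing over the landed bridge lemmas:

* WLOG `0 < m`: `Kerr.Costa2019.coneKernelBound_of_pos` (conjugation symmetry of the normalised
  pair, `TeukolskyRadialConjugation.lean`);
* the cone stays away from `ω = 0` once `ε₀ ≤ a₁/(8M²)` (`Kerr.Costa2019.abs_omega_lower_of_cone`),
  so the constants of the core are shrunk to `a₁ ⊔ M/2`, `ε₀ ⊓ (a₁ ⊔ M/2)/(8M²)` (`cone_constants`);
* a tortoise radius `ρ` exists (`Kerr.exists_isTortoiseRadius`) and is a strictly increasing
  continuous surjection onto `(r₊, ∞)` (`exists_tortoise_eq`), so `r = ρ x`, `r′ = ρ x′`, `x ≤ x′`;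
* `u = √(ρ² + a²)·R ∘ ρ` solves Carter's equation with `u′ = (Δ/(r² + a²))·d/dr[√(r² + a²) R]`
  (`Kerr.schrodingerForm`), and `u_𝓗 u_𝓘′ − u_𝓘 u_𝓗′ = 𝔚` (`Kerr.wronskian_schrodingerForm`);
* the end data are `Kerr.Costa2019.tendsto_norm_(deriv_)horizonSolution` composed with
  `ρ → r₊⁺` and `Kerr.Costa2019.tendsto_norm_(deriv_)infinitySolution` composed with `ρ → ∞`;
  the fluxes are `Im(ū u′) = Δ·Im(R̄ R′)` (`im_conj_u_mul_u₁`) evaluated by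
  `Kerr.Costa2019.radialFlux_eq_of_normalisedHorizon` (`= −(ω − mω₊)`) and
  `Kerr.Costa2019.radialFlux_eq_of_normalisedInfinity` (`= ω`).

No unproved fact is used.
-/

-- the doubled `FinalStateConjecture.FinalStateConjecture` path component trips dupNamespace
set_option linter.dupNamespace false

noncomputable section

namespace Summit.FinalStateConjecture.FinalStateConjecture.Theorems.KappaExplicitWaveDecay.OlverDunsterUniformReduction

open Literature.Geometry.Lorentzian
open MeasureTheory Filter Set Complex
open scoped Topology Manifold ENNReal ComplexConjugate

/-! ### Constants: the cone stays away from `ω = 0` -/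

/-- **Shrinking the cone constants so that `ω ≠ 0`.** Given `a₁ < M`, `ε₀ > 0` (`M > 0`), the
constants `a₂ = a₁ ⊔ M/2 < M` and `ε₂ = ε₀ ⊓ a₂/(8M²) > 0` satisfy `a₁ ≤ a₂`, `ε₂ ≤ ε₀`, and every
`ω` with `|ω − mω₊| ≤ ε₂|m|`, `m ≠ 0`, `a₂ ≤ |a|` is non-zero: by
`Kerr.Costa2019.abs_omega_lower_of_cone`, `|ω| ≥ (a₂/(4M²) − ε₂)|m| ≥ a₂/(8M²) > 0`. -/
private theorem cone_constants {M a₁ ε₀ : ℝ} (hM : 0 < M) (ha₁ : a₁ < M) (hε₀ : 0 < ε₀) :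
    ∃ a₂ ε₂ : ℝ, a₂ < M ∧ 0 < ε₂ ∧ a₁ ≤ a₂ ∧ ε₂ ≤ ε₀ ∧
      ∀ (a ω : ℝ) (m : ℤ), a₂ ≤ |a| → m ≠ 0 →
        |ω - m * Kerr.horizonAngularVelocity M a| ≤ ε₂ * |(m : ℝ)| → ω ≠ 0 := by
  have hpos : 0 < max a₁ (M / 2) := lt_max_of_lt_right (half_pos hM)
  refine ⟨max a₁ (M / 2), min ε₀ (max a₁ (M / 2) / (8 * M ^ 2)), max_lt ha₁ (by linarith),
    lt_min hε₀ (by positivity), le_max_left _ _, min_le_left _ _, fun a ω m ha hm hcone ↦ ?_⟩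
  have h1 := Kerr.Costa2019.abs_omega_lower_of_cone hM hpos ha hcone
  have hμ : (1 : ℝ) ≤ |(m : ℝ)| := by exact_mod_cast Int.one_le_abs hm
  have h2 : min ε₀ (max a₁ (M / 2) / (8 * M ^ 2)) ≤ max a₁ (M / 2) / (8 * M ^ 2) :=
    min_le_right _ _
  have h3 : max a₁ (M / 2) / (4 * M ^ 2) = 2 * (max a₁ (M / 2) / (8 * M ^ 2)) := by ring
  have h4 : 0 < max a₁ (M / 2) / (8 * M ^ 2) := by positivity
  have h5 : max a₁ (M / 2) / (8 * M ^ 2) ≤ |ω| := by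
    calc max a₁ (M / 2) / (8 * M ^ 2) = max a₁ (M / 2) / (8 * M ^ 2) * 1 := (mul_one _).symm
      _ ≤ (max a₁ (M / 2) / (4 * M ^ 2) - min ε₀ (max a₁ (M / 2) / (8 * M ^ 2))) * |(m : ℝ)| :=
          mul_le_mul (by linarith) hμ zero_le_one (by linarith)
      _ ≤ |ω| := h1
  exact abs_pos.mp (h4.trans_le h5)

/-! ### The tortoise radius: `ρ → r₊⁺` at `−∞`, surjectivity onto `(r₊, ∞)` -/

/-- A tortoise radius function tends to `r₊` FROM ABOVE as `x → −∞` (`ρ > r₊` everywhere). -/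
private theorem tendsto_tortoise_nhdsGT {M a : ℝ} {ρ : ℝ → ℝ} (hρ : Kerr.IsTortoiseRadius M a ρ) :
    Tendsto ρ atBot (𝓝[>] Kerr.rPlus M a) :=
  tendsto_nhdsWithin_iff.2 ⟨hρ.tendsto_atBot, Eventually.of_forall hρ.rPlus_lt⟩

/-- A tortoise radius function takes every value `r > r₊` (it is continuous, `→ r₊` at `−∞` and
`→ ∞` at `+∞`: intermediate value theorem). -/
private theorem exists_tortoise_eq {M a : ℝ} {ρ : ℝ → ℝ} (hρ : Kerr.IsTortoiseRadius M a ρ)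
    {r : ℝ} (hr : Kerr.rPlus M a < r) : ∃ x, ρ x = r := by
  obtain ⟨x₁, hx₁⟩ := (hρ.tendsto_atBot.eventually_lt_const hr).exists
  obtain ⟨x₂, hx₂⟩ := (hρ.tendsto_atTop.eventually (eventually_ge_atTop r)).exists
  exact mem_range_of_exists_le_of_exists_ge hρ.continuous ⟨x₁, hx₁.le⟩ ⟨x₂, hx₂⟩

/-! ### The weight `S = √(r² + a²)`: `‖S·z‖`, `dS/dr`, and the flux `Im(ū u′) = Δ·Im(R̄ R′)` -/

/-- `‖√(r² + a²) · z‖ = √(r² + a²) · ‖z‖`. -/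
private theorem norm_weight_mul (a r : ℝ) (z : ℂ) :
    ‖((Real.sqrt (r ^ 2 + a ^ 2) : ℝ) : ℂ) * z‖ = Real.sqrt (r ^ 2 + a ^ 2) * ‖z‖ := by
  rw [norm_mul, Complex.norm_of_nonneg (Real.sqrt_nonneg _)]

-- adapted from Literature/Geometry/Lorentzian/TeukolskyHorizonNormalisedLimits.lean
/-- `d/ds (s² + a²)^{1/2} = s/(s² + a²)^{1/2}` at a point `y` with `y² + a² > 0`. -/
private theorem hasDerivAt_weight {a y : ℝ} (hy : 0 < y ^ 2 + a ^ 2) :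
    HasDerivAt (fun s : ℝ ↦ Real.sqrt (s ^ 2 + a ^ 2)) (y / Real.sqrt (y ^ 2 + a ^ 2)) y := by
  have h1 : HasDerivAt (fun s : ℝ ↦ s ^ 2 + a ^ 2) (2 * y) y := by
    simpa using (hasDerivAt_pow 2 y).add_const (a ^ 2)
  refine (h1.sqrt hy.ne').congr_deriv ?_
  rw [mul_div_mul_left _ _ (two_ne_zero' ℝ)]

/-- The algebra of the flux in the weighted variable: for real `S`, `S′`, `D` and complex `z`, `w`,
`Im( conj(S z) · D (S′ z + S w) ) = D S² · Im(z̄ w)` (`conj(z) z` is real). -/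
private theorem im_conj_weight_mul (S S' D : ℝ) (z w : ℂ) :
    (conj ((S : ℂ) * z) * ((D : ℂ) * ((S' : ℂ) * z + (S : ℂ) * w))).im =
      D * S ^ 2 * (conj z * w).im := by
  simp only [Complex.mul_im, Complex.mul_re, Complex.add_re, Complex.add_im, map_mul,
    Complex.conj_ofReal, Complex.conj_re, Complex.conj_im, Complex.ofReal_re, Complex.ofReal_im]
  ring

/-- **`Im(ū u₁) = D·(r² + a²)·Im(R̄ R′)`** for `u = √(r² + a²) R` and
`u₁ = D · d/dr[√(r² + a²) R]` at a point `r` where `R` is differentiable (`r² + a² > 0`): the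
product rule `d/dr[S R] = (r/S) R + S R′` and `im_conj_weight_mul`, `S² = r² + a²`. With
`D = Δ/(r² + a²)` this is the tortoise flux `Im(ū du/dr*) = Δ·Im(R̄ dR/dr)`. -/
private theorem im_conj_u_mul_u₁ (a D : ℝ) {R : ℝ → ℂ} {r : ℝ} (hA : 0 < r ^ 2 + a ^ 2)
    (hR : DifferentiableAt ℝ R r) :
    (conj (((Real.sqrt (r ^ 2 + a ^ 2) : ℝ) : ℂ) * R r) *
        (((D : ℝ) : ℂ) *
          deriv (fun s : ℝ ↦ ((Real.sqrt (s ^ 2 + a ^ 2) : ℝ) : ℂ) * R s) r)).im =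
      D * (r ^ 2 + a ^ 2) * (conj (R r) * deriv R r).im := by
  rw [((hasDerivAt_weight hA).ofReal_comp.fun_mul hR.hasDerivAt).deriv, im_conj_weight_mul,
    Real.sq_sqrt hA.le]

/-! ### Carter's equation for `u = √(ρ² + a²)·R ∘ ρ` and the end data -/

/-- **Carter's equation along a tortoise radius** (`Kerr.schrodingerForm` with the second
derivative written as `−(ω² − V(ρ x))·u(x)`): for a classical solution `R` of the scalar radial
Teukolsky ODE (`λ = Λ − a²ω²`) and a tortoise radius `ρ`, `u = √(ρ² + a²)·R ∘ ρ` has a derivative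
`u₁` on `ℝ` with `u₁′ = −(ω² − V(ρ x)) u`, and `u₁ = (Δ/(r² + a²))·d/dr[√(r² + a²) R]` at `r = ρ x`. -/
private theorem carter_hasDerivAt {M a ω Λ : ℝ} {m : ℤ} (hM : 0 < M) (ha : |a| < M) {R : ℝ → ℂ}
    (hR : Kerr.IsRadialTeukolskySolution M a 0 ω m (Λ - a ^ 2 * ω ^ 2) R) {ρ : ℝ → ℝ}
    (hρ : Kerr.IsTortoiseRadius M a ρ) :
    ∃ u₁ : ℝ → ℂ,
      (∀ x, HasDerivAt (fun y ↦ ((Real.sqrt (ρ y ^ 2 + a ^ 2) : ℝ) : ℂ) * R (ρ y)) (u₁ x) x ∧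
        HasDerivAt u₁ (-(((ω ^ 2 - Kerr.sepPotential M a ω m Λ (ρ x) : ℝ) : ℂ) *
          (((Real.sqrt (ρ x ^ 2 + a ^ 2) : ℝ) : ℂ) * R (ρ x)))) x) ∧
      ∀ x, u₁ x = ((Kerr.delta M a (ρ x) / (ρ x ^ 2 + a ^ 2) : ℝ) : ℂ) *
          deriv (fun r : ℝ ↦ ((Real.sqrt (r ^ 2 + a ^ 2) : ℝ) : ℂ) * R r) (ρ x) := by
  obtain ⟨u₁, u₂, h⟩ := Kerr.schrodingerForm hM ha hR hρ
  refine ⟨u₁, fun x ↦ ⟨(h x).1, ?_⟩, fun x ↦ (h x).2.2.2⟩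
  obtain ⟨-, h2, h3, -⟩ := h x
  rwa [eq_neg_of_add_eq_zero_left h3] at h2

/-- **Horizon data of `u_𝓗 = √(ρ² + a²)·R_𝓗 ∘ ρ`** (`R_𝓗` a classical radial solution normalised
at `𝓗⁺`, `u₁` its tortoise derivative): `‖u_𝓗 x‖ → 1` and `‖u₁ x‖ → |ω − mω₊|` as `x → −∞`
(`Kerr.Costa2019.tendsto_norm_(deriv_)horizonSolution` along `ρ → r₊⁺`), and the flux
`Im(ū_𝓗 u₁) ≡ −(ω − mω₊)` (`Kerr.Costa2019.radialFlux_eq_of_normalisedHorizon`). -/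
private theorem horizon_data {M a ω m lam : ℝ} (hM : 0 < M) (hsub : Kerr.IsSubextremal M a)
    {R : ℝ → ℂ} (hR : Kerr.IsRadialTeukolskySolution M a 0 ω m lam R)
    (hn : Kerr.IsNormalisedHorizonSolution M a 0 ω m R) {ρ : ℝ → ℝ}
    (hρ : Kerr.IsTortoiseRadius M a ρ) {u₁ : ℝ → ℂ}
    (hu₁ : ∀ x, u₁ x = ((Kerr.delta M a (ρ x) / (ρ x ^ 2 + a ^ 2) : ℝ) : ℂ) *
      deriv (fun r : ℝ ↦ ((Real.sqrt (r ^ 2 + a ^ 2) : ℝ) : ℂ) * R r) (ρ x)) :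
    Tendsto (fun x ↦ ‖((Real.sqrt (ρ x ^ 2 + a ^ 2) : ℝ) : ℂ) * R (ρ x)‖) atBot (𝓝 1) ∧
    Tendsto (fun x ↦ ‖u₁ x‖) atBot (𝓝 |ω - m * Kerr.horizonAngularVelocity M a|) ∧
    ∀ x, (conj (((Real.sqrt (ρ x ^ 2 + a ^ 2) : ℝ) : ℂ) * R (ρ x)) * u₁ x).im =
      -(ω - m * Kerr.horizonAngularVelocity M a) := by
  have ha : |a| < M := hsub
  have hbot := tendsto_tortoise_nhdsGT hρ
  refine ⟨?_, ?_, fun x ↦ ?_⟩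
  · have h : Tendsto (fun x ↦ Real.sqrt (ρ x ^ 2 + a ^ 2) * ‖R (ρ x)‖) atBot (𝓝 1) :=
      (Kerr.Costa2019.tendsto_norm_horizonSolution hn).comp hbot
    exact h.congr fun x ↦ (norm_weight_mul a (ρ x) (R (ρ x))).symm
  · have h : Tendsto (fun x ↦ Kerr.delta M a (ρ x) / (ρ x ^ 2 + a ^ 2) *
        ‖deriv (fun s : ℝ ↦ ((Real.sqrt (s ^ 2 + a ^ 2) : ℝ) : ℂ) * R s) (ρ x)‖) atBot
        (𝓝 |ω - m * Kerr.horizonAngularVelocity M a|) :=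
      (Kerr.Costa2019.tendsto_norm_deriv_horizonSolution hM ha hn).comp hbot
    refine h.congr fun x ↦ ?_
    rw [hu₁ x, norm_mul, Complex.norm_of_nonneg (hρ.deriv_pos hsub x).le]
  · obtain ⟨R', R'', hd⟩ := id hR
    have hr := hρ.rPlus_lt x
    have hA := hρ.sq_add_sq_pos hsub x
    rw [hu₁ x, im_conj_u_mul_u₁ a _ hA (hd _ hr).1.differentiableAt, div_mul_cancel₀ _ hA.ne',
      Kerr.Costa2019.radialFlux_eq_of_normalisedHorizon ha hR hn hr]

/-- **Infinity data of `u_𝓘 = √(ρ² + a²)·R_𝓘 ∘ ρ`** (`R_𝓘` a classical radial solution normalised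
at `𝓘⁺`, `ω ≠ 0`, `u₁` its tortoise derivative): `‖u_𝓘 x‖ → 1` and `‖u₁ x‖ → |ω|` as `x → +∞`
(`Kerr.Costa2019.tendsto_norm_(deriv_)infinitySolution` along `ρ → ∞`), and the flux
`Im(ū_𝓘 u₁) ≡ ω` (`Kerr.Costa2019.radialFlux_eq_of_normalisedInfinity`). -/
private theorem infinity_data {M a ω m lam : ℝ} (hM : 0 < M) (hsub : Kerr.IsSubextremal M a)
    (hω : ω ≠ 0) {R : ℝ → ℂ} (hR : Kerr.IsRadialTeukolskySolution M a 0 ω m lam R)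
    (hn : Kerr.IsNormalisedInfinitySolution M 0 ω R) {ρ : ℝ → ℝ}
    (hρ : Kerr.IsTortoiseRadius M a ρ) {u₁ : ℝ → ℂ}
    (hu₁ : ∀ x, u₁ x = ((Kerr.delta M a (ρ x) / (ρ x ^ 2 + a ^ 2) : ℝ) : ℂ) *
      deriv (fun r : ℝ ↦ ((Real.sqrt (r ^ 2 + a ^ 2) : ℝ) : ℂ) * R r) (ρ x)) :
    Tendsto (fun x ↦ ‖((Real.sqrt (ρ x ^ 2 + a ^ 2) : ℝ) : ℂ) * R (ρ x)‖) atTop (𝓝 1) ∧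
    Tendsto (fun x ↦ ‖u₁ x‖) atTop (𝓝 |ω|) ∧
    ∀ x, (conj (((Real.sqrt (ρ x ^ 2 + a ^ 2) : ℝ) : ℂ) * R (ρ x)) * u₁ x).im = ω := by
  have ha : |a| < M := hsub
  refine ⟨?_, ?_, fun x ↦ ?_⟩
  · have h : Tendsto (fun x ↦ Real.sqrt (ρ x ^ 2 + a ^ 2) * ‖R (ρ x)‖) atTop (𝓝 1) :=
      (Kerr.Costa2019.tendsto_norm_infinitySolution (a := a) hn).comp hρ.tendsto_atTop
    exact h.congr fun x ↦ (norm_weight_mul a (ρ x) (R (ρ x))).symm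
  · have h : Tendsto (fun x ↦ Kerr.delta M a (ρ x) / (ρ x ^ 2 + a ^ 2) *
        ‖deriv (fun s : ℝ ↦ ((Real.sqrt (s ^ 2 + a ^ 2) : ℝ) : ℂ) * R s) (ρ x)‖) atTop
        (𝓝 |ω|) :=
      (Kerr.Costa2019.tendsto_norm_deriv_infinitySolution hM ha hω hR hn).comp hρ.tendsto_atTop
    refine h.congr fun x ↦ ?_
    rw [hu₁ x, norm_mul, Complex.norm_of_nonneg (hρ.deriv_pos hsub x).le]
  · obtain ⟨R', R'', hd⟩ := id hR
    have hr := hρ.rPlus_lt x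
    have hA := hρ.sq_add_sq_pos hsub x
    rw [hu₁ x, im_conj_u_mul_u₁ a _ hA (hd _ hr).1.differentiableAt, div_mul_cancel₀ _ hA.ne',
      Kerr.Costa2019.radialFlux_eq_of_normalisedInfinity hM ha hω hR hn hr]

/-! ### The stub -/

/-- **S5a-R · `stub_tortoiseReduction` — the TdC kernel bound from its tortoise-variable core,
for ANY frequency regime `P` invariant under `(ω, m) ↦ (−ω, −m)`.** Given the analytic core in
Carter's variables (the hypothesis: for solutions `u_𝓗, u_𝓘` of `u″ + (ω² − V(ρ x))u = 0` along a
tortoise radius `ρ` with the horizon/infinity data `‖u‖ → 1`, `‖u′‖ → |ω − mω₊|` resp. `|ω|`,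
fluxes `−(ω − mω₊)` resp. `ω`, and `0 < m`, the two-point bound
`‖u_𝓗(x)‖‖u_𝓘(x′)‖ ≤ C|m|^N κ^{-N}‖u_𝓗 u_𝓘′ − u_𝓘 u_𝓗′‖(x)` for `x ≤ x′`, `ρ x′ ≥ r₊ + θ(r₊ − r₋)`),
the registered `R`-language bound for the TdC-normalised pair (`m ≠ 0`) follows. Proof: WLOG
`0 < m` (`Kerr.Costa2019.coneKernelBound_of_pos`, using the `P`-invariance); shrink `ε₀` so that
`ω ≠ 0` in the cone (`cone_constants`); pick a tortoise radius `ρ` (`Kerr.exists_isTortoiseRadius`)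
and write `r = ρ x`, `r′ = ρ x′` (`exists_tortoise_eq`, strict monotonicity); put
`u := √(ρ² + a²)·R ∘ ρ` with the derivative witness of `Kerr.schrodingerForm` (`carter_hasDerivAt`),
take the end data from `horizon_data` / `infinity_data`, apply the core at `(x, x′)`, and convert
back with `‖u x‖ = √(r² + a²)‖R r‖` and `Kerr.wronskian_schrodingerForm`
(`u_𝓗 u_𝓘′ − u_𝓘 u_𝓗′ = Kerr.radialWronskian M a 0 R_𝓗 R_𝓘 (ρ x)`). -/
theorem stub_tortoiseReduction :
    ∀ P : ℝ → ℝ → ℝ → ℤ → Prop, (∀ M a ω m, P M a ω m → P M a (-ω) (-m)) →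
    (∀ M : ℝ, 0 < M → ∀ θ : ℝ, 0 < θ → ∃ (a₁ ε₀ C : ℝ) (N : ℕ), a₁ < M ∧ 0 < ε₀ ∧ 0 < C ∧
      ∀ a : ℝ, a₁ ≤ |a| → Kerr.IsSubextremal M a →
        ∀ (ω : ℝ) (m : ℤ) (Λ : ℝ), Kerr.IsAdmissibleTriple a ω m Λ → 0 < m →
          |ω - m * Kerr.horizonAngularVelocity M a| ≤ ε₀ * |(m : ℝ)| → P M a ω m →
            ∀ ρ : ℝ → ℝ, Kerr.IsTortoiseRadius M a ρ →
            ∀ uH uH₁ uI uI₁ : ℝ → ℂ,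
              (∀ x, HasDerivAt uH (uH₁ x) x ∧
                HasDerivAt uH₁ (-(((ω ^ 2 - Kerr.sepPotential M a ω m Λ (ρ x) : ℝ) : ℂ) * uH x)) x) →
              (∀ x, HasDerivAt uI (uI₁ x) x ∧
                HasDerivAt uI₁ (-(((ω ^ 2 - Kerr.sepPotential M a ω m Λ (ρ x) : ℝ) : ℂ) * uI x)) x) →
              Tendsto (fun x ↦ ‖uH x‖) atBot (𝓝 1) →
              Tendsto (fun x ↦ ‖uH₁ x‖) atBot (𝓝 |ω - m * Kerr.horizonAngularVelocity M a|) →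
              (∀ x, (starRingEnd ℂ (uH x) * uH₁ x).im = -(ω - m * Kerr.horizonAngularVelocity M a)) →
              Tendsto (fun x ↦ ‖uI x‖) atTop (𝓝 1) →
              Tendsto (fun x ↦ ‖uI₁ x‖) atTop (𝓝 |ω|) →
              (∀ x, (starRingEnd ℂ (uI x) * uI₁ x).im = ω) →
                ∀ x x' : ℝ, x ≤ x' → Kerr.rPlus M a + θ * (Kerr.rPlus M a - Kerr.rMinus M a) ≤ ρ x' →
                  ‖uH x‖ * ‖uI x'‖ ≤
                    C * |(m : ℝ)| ^ N * (Kerr.surfaceGravity M a)⁻¹ ^ N * ‖uH x * uI₁ x - uI x * uH₁ x‖) →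
    (∀ M : ℝ, 0 < M → ∀ θ : ℝ, 0 < θ → ∃ (a₁ ε₀ C : ℝ) (N : ℕ), a₁ < M ∧ 0 < ε₀ ∧ 0 < C ∧
      ∀ a : ℝ, a₁ ≤ |a| → Kerr.IsSubextremal M a →
        ∀ (ω : ℝ) (m : ℤ) (Λ : ℝ), Kerr.IsAdmissibleTriple a ω m Λ → m ≠ 0 →
          |ω - m * Kerr.horizonAngularVelocity M a| ≤ ε₀ * |(m : ℝ)| → P M a ω m →
            ∀ RH RI : ℝ → ℂ,
              Kerr.IsRadialTeukolskySolution M a 0 ω m (Λ - a ^ 2 * ω ^ 2) RH →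
              Kerr.IsNormalisedHorizonSolution M a 0 ω m RH →
              Kerr.IsRadialTeukolskySolution M a 0 ω m (Λ - a ^ 2 * ω ^ 2) RI →
              Kerr.IsNormalisedInfinitySolution M 0 ω RI →
                ∀ r r' : ℝ, Kerr.rPlus M a < r → r ≤ r' →
                  Kerr.rPlus M a + θ * (Kerr.rPlus M a - Kerr.rMinus M a) ≤ r' →
                    Real.sqrt (r ^ 2 + a ^ 2) * ‖RH r‖ * (Real.sqrt (r' ^ 2 + a ^ 2) * ‖RI r'‖) ≤
                      C * |(m : ℝ)| ^ N * (Kerr.surfaceGravity M a)⁻¹ ^ N * ‖Kerr.radialWronskian M a 0 RH RI r‖) := by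
  intro P hP hcore
  -- WLOG `0 < m` (conjugation symmetry of the normalised pair, `P` invariant)
  refine Kerr.Costa2019.coneKernelBound_of_pos P hP fun M hM θ hθ ↦ ?_
  obtain ⟨a₁, ε₀, C, N, ha₁, hε₀, hC, hK⟩ := hcore M hM θ hθ
  -- shrink the constants so that `ω ≠ 0` in the cone
  obtain ⟨a₂, ε₂, ha₂, hε₂, ha₁₂, hε₂₀, hω₂⟩ := cone_constants hM ha₁ hε₀
  refine ⟨a₂, ε₂, C, N, ha₂, hε₂, hC, ?_⟩
  intro a ha hsub ω m Λ hadm hm hcone hPw RH RI hH hnH hI hnI r r' hr hrr' hr'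
  have ha' : |a| < M := hsub
  have hω : ω ≠ 0 := hω₂ a ω m ha hm.ne' hcone
  have ha₁a : a₁ ≤ |a| := ha₁₂.trans ha
  have hcone' : |ω - m * Kerr.horizonAngularVelocity M a| ≤ ε₀ * |(m : ℝ)| :=
    hcone.trans (mul_le_mul_of_nonneg_right hε₂₀ (abs_nonneg _))
  -- Carter's variable: a tortoise radius `ρ`, `r = ρ x`, `r' = ρ x'`, `x ≤ x'`
  obtain ⟨ρ, hρ⟩ := Kerr.exists_isTortoiseRadius hsub
  obtain ⟨x, rfl⟩ := exists_tortoise_eq hρ hr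
  obtain ⟨x', rfl⟩ := exists_tortoise_eq hρ (hr.trans_le hrr')
  have hxx' : x ≤ x' := (hρ.strictMono hsub).le_iff_le.1 hrr'
  -- `u = √(ρ² + a²)·R ∘ ρ`, its tortoise derivative, and the end data
  obtain ⟨uH₁, hduH, huH₁⟩ := carter_hasDerivAt hM ha' hH hρ
  obtain ⟨uI₁, hduI, huI₁⟩ := carter_hasDerivAt hM ha' hI hρ
  obtain ⟨hlimH, hlimH₁, hfluxH⟩ := horizon_data hM hsub hH hnH hρ huH₁
  obtain ⟨hlimI, hlimI₁, hfluxI⟩ := infinity_data hM hsub hω hI hnI hρ huI₁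
  -- the core bound at `(x, x')`
  have key : ‖((Real.sqrt (ρ x ^ 2 + a ^ 2) : ℝ) : ℂ) * RH (ρ x)‖ *
      ‖((Real.sqrt (ρ x' ^ 2 + a ^ 2) : ℝ) : ℂ) * RI (ρ x')‖ ≤
      C * |(m : ℝ)| ^ N * (Kerr.surfaceGravity M a)⁻¹ ^ N *
        ‖((Real.sqrt (ρ x ^ 2 + a ^ 2) : ℝ) : ℂ) * RH (ρ x) * uI₁ x -
          ((Real.sqrt (ρ x ^ 2 + a ^ 2) : ℝ) : ℂ) * RI (ρ x) * uH₁ x‖ :=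
    hK a ha₁a hsub ω m Λ hadm hm hcone' hPw ρ hρ
      (fun y ↦ ((Real.sqrt (ρ y ^ 2 + a ^ 2) : ℝ) : ℂ) * RH (ρ y)) uH₁
      (fun y ↦ ((Real.sqrt (ρ y ^ 2 + a ^ 2) : ℝ) : ℂ) * RI (ρ y)) uI₁
      hduH hduI hlimH hlimH₁ hfluxH hlimI hlimI₁ hfluxI x x' hxx' hr'
  -- back to `R`: `‖u‖ = √(r² + a²)‖R‖` and `u_𝓗 u_𝓘′ − u_𝓘 u_𝓗′ = 𝔚`
  have hdH : DifferentiableAt ℝ RH (ρ x) := by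
    obtain ⟨R', R'', hd⟩ := hH
    exact (hd _ (hρ.rPlus_lt x)).1.differentiableAt
  have hdI : DifferentiableAt ℝ RI (ρ x) := by
    obtain ⟨R', R'', hd⟩ := hI
    exact (hd _ (hρ.rPlus_lt x)).1.differentiableAt
  rw [norm_weight_mul, norm_weight_mul, huH₁ x, huI₁ x,
    Kerr.wronskian_schrodingerForm ha' hρ hdH hdI] at key
  exact key

end Summit.FinalStateConjecture.FinalStateConjecture.Theorems.KappaExplicitWaveDecay.OlverDunsterUniformReduction

end
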